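import Summits.QuantumFields.BalabanUV.Beta.FP.CombSliceJetLetters
import Summits.QuantumFields.BalabanUV.Beta.FP.CompositeWardLetters

/-!
# `BalabanUV.Beta.FP.SliceTransportConjugation` — road «FP» for binder row D1, ROUTE T, presentation T-β of the owner's design note W-FP-17-11:
# **THE SECOND VARIATION IS ADDITIVE OVER PRODUCTS AND INVARIANT UNDER UNIMODULAR CONJUGATION TRANSPORT** (jets only)

WHAT.  (§1) [folklore] `log|det(L·M·R)| = log|det L| + log|det M| + log|det R|` at the level of 2-jets: for invertible zeroth jets,
`secondVar (L₀M₀R₀) ((LMR)₁) ((LMR)₂) = secondVar L₀ L₁ L₂ + secondVar M₀ M₁ M₂ + secondVar R₀ R₁ R₂` with the product-rule words `(LMR)₁`, `(LMR)₂`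
DISPLAYED (`secondVar_mul₃`); hence (§2) **CONJUGATION TRANSPORT**: if the transporting families are UNIMODULAR at jet level (`secondVar L₀ L₁ L₂ = 0`,
`secondVar R₀ R₁ R₂ = 0` — e.g. `L = Ad(g(u))ᵀ`, `R = Ad(g(u))` with `det Ad = 1`, or block-diagonal sums of such) then the conjugated 2-jet has the SAME
`secondVar` as the raw one (`secondVar_conj_of_unimodular`).  USE (W-FP-17-11, T-β): the one-shot and the nested literals dress the insertion slot by
DIFFERENT static comb projectors, so their background families differ by an infinitesimal gauge transformation; gauge-COVARIANT sliced forms transform by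
`kkt (AᵀKA) [ĀQA; τ] = diag(Aᵀ, Ā, 1) · kkt K [Q; τA⁻¹] · diag(A, Āᵀ, 1)`, so with `L := diag(Aᵀ, Ā, 1)`-jets, `R := diag(A, Āᵀ, 1)`-jets and
`M := kkt K [Q; τA⁻¹]`-jets the transported sliced `secondVar` equals the raw one WITH THE SLICE MOVED by `A⁻¹` — after which the slice exchange
(`SliceExchangeJets`, p308565) prices the move by Faddeev–Popov terms that are CONSTANT in each literal's own chart.  This file is the generic jet
calculus of that sentence (§1: products; §2: transpose, block-diagonal transports (the static slice block's `secondVar _ 0 0 = 0` is leaf-06's `CombSliceJetLetters.secondVar_zero_jets`), `diag(Aᵀ, Ā, 1)` ∕ `diag(A, Āᵀ, 1)` are unimodular iff `A`, `Ā` are,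
and the trilinear conjugation identity `conj_kkt_fromRows` whose product-rule sums ARE the conjugated words `kkt (AᵀKA)ₙ [(ĀQA)ₙ; T(A⁻¹A)ₙ]`); the covariance of
the literal's tables (the `f*`∕`a*` Ward rows) and the unimodularity of the colour-stripped adjoint transport are the dictionary's letters, NOT proved here.

HONEST DEPENDENCY (page 1, mandatory): continuum YM on T⁴ ⇐ BetaPertH ∧ nine spine estimates (0/9 proved); BetaPertH ⇐ (D1) ∧ (D4) ∧ CAP+tail;
G-an2-4 gates asym, D1 and NE2/3/4.  HONEST FRAMING (cell contract, verbatim): «discharging `BetaPertH` makes Bałaban's UV stability UNCONDITIONAL —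
a real constructive-QFT result; it is NOT the continuum limit and NOT the Clay problem.»  ABSOLUTE RULE (cell charter, verbatim): «No internally-minted
statement may enter as a cited fact. Every hypothesis is either kernel-proved in this package or a verbatim quotation of a PUBLISHED theorem with page
reference. The manuscript(s) under audit are NOT citable for their own disputed steps — they are the thing under adjudication; programme-internal
(2001/route/tribunal) claims are never citable.»  [folklore] matrix calculus on `Mathlib` + the road's jet toolkit; no `def`, no `def … : Prop`, nothing
cited, 0 sorry; 0∕4 row-D1 binders; NOT (T-ID), NOT SDF, NOT D1, NOT BetaPertH, NOT continuum, NOT Clay.  Road «FP» OWNER, b2b-balaban-beta-d1-p3 gen 17,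
2026-08-22.  No existing file touched.
-/

noncomputable section

namespace Summit.QuantumFields.BalabanUV.Beta.FP.SliceTransportConjugation

open Matrix Filter
open scoped Topology
open Literature.MathematicalPhysics.QuantumFieldTheory.Balaban1983to89.Beta.Composition (kkt)
open Summit.QuantumFields.BalabanUV.Beta.D1BFx.LogDetSecondVariation (secondVar secondVar_comb_eq_zero)
open Summit.QuantumFields.BalabanUV.Beta.D1BFx.SliceTransferModel (hasDerivAt_matMul)
open Summit.QuantumFields.BalabanUV.Beta.D1BFx.SliceTransferJets (pc lc of_pc of_lc of_pc_zero of_lc_zero hasDerivAt_pc hasDerivAt_lc)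
open Summit.QuantumFields.BalabanUV.Beta.FP.CombSliceJetLetters (secondVar_zero_jets)
open Summit.QuantumFields.BalabanUV.Beta.FP.CompositeWardLetters (fromCols_add)

/-! ## §1 `log|det|` is additive over products — at the level of 2-jets -/

section Product

variable {ι : Type*} [Fintype ι] [DecidableEq ι]

/-- [folklore] **THE SECOND VARIATION IS ADDITIVE OVER PRODUCTS.**  For 2-jets `(L₀,L₁,L₂)`, `(M₀,M₁,M₂)` with invertible zeroth jets, the product 2-jet
(`L₀M₀`, `L₁M₀ + L₀M₁`, `L₂M₀ + L₁M₁ + (L₁M₁ + L₀M₂)` — the product-rule words) has `secondVar = secondVar L + secondVar M`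
(`log|det(L·M)| = log|det L| + log|det M|` along the Taylor curves). -/
theorem secondVar_mul₂ (L₀ L₁ L₂ M₀ M₁ M₂ : Matrix ι ι ℝ) (hL : L₀.det ≠ 0) (hM : M₀.det ≠ 0) :
    secondVar (L₀ * M₀) (L₁ * M₀ + L₀ * M₁) (L₂ * M₀ + L₁ * M₁ + (L₁ * M₁ + L₀ * M₂)) = secondVar L₀ L₁ L₂ + secondVar M₀ M₁ M₂ := by
  -- the product curve and its first-derivative curve
  have hCd : ∀ u, HasDerivAt (fun v => Matrix.of.symm (Matrix.of (pc L₀ L₁ L₂ v) * Matrix.of (pc M₀ M₁ M₂ v)))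
      ((fun v => Matrix.of.symm (Matrix.of (lc L₁ L₂ v) * Matrix.of (pc M₀ M₁ M₂ v) + Matrix.of (pc L₀ L₁ L₂ v) * Matrix.of (lc M₁ M₂ v))) u) u :=
    fun u => hasDerivAt_matMul (hasDerivAt_pc L₀ L₁ L₂ u) (hasDerivAt_pc M₀ M₁ M₂ u)
  have hC₁d : HasDerivAt (fun v => Matrix.of.symm (Matrix.of (lc L₁ L₂ v) * Matrix.of (pc M₀ M₁ M₂ v) + Matrix.of (pc L₀ L₁ L₂ v) * Matrix.of (lc M₁ M₂ v)))
      (Matrix.of.symm ((L₂ * Matrix.of (pc M₀ M₁ M₂ 0) + Matrix.of (lc L₁ L₂ 0) * Matrix.of (lc M₁ M₂ 0))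
        + (Matrix.of (lc L₁ L₂ 0) * Matrix.of (lc M₁ M₂ 0) + Matrix.of (pc L₀ L₁ L₂ 0) * M₂))) 0 :=
    (hasDerivAt_matMul (hasDerivAt_lc L₁ L₂ 0) (hasDerivAt_pc M₀ M₁ M₂ 0)).add
      (hasDerivAt_matMul (hasDerivAt_pc L₀ L₁ L₂ 0) (hasDerivAt_lc M₁ M₂ 0))
  -- non-degeneracy at `0`
  have hdC : (Matrix.of ((fun v => Matrix.of.symm (Matrix.of (pc L₀ L₁ L₂ v) * Matrix.of (pc M₀ M₁ M₂ v))) 0)).det ≠ 0 := by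
    show (Matrix.of (Matrix.of.symm (Matrix.of (pc L₀ L₁ L₂ 0) * Matrix.of (pc M₀ M₁ M₂ 0)))).det ≠ 0
    rw [Equiv.apply_symm_apply, of_pc_zero, of_pc_zero, Matrix.det_mul]; exact mul_ne_zero hL hM
  have hdL : (Matrix.of (pc L₀ L₁ L₂ 0)).det ≠ 0 := by rw [of_pc_zero]; exact hL
  have hdM : (Matrix.of (pc M₀ M₁ M₂ 0)).det ≠ 0 := by rw [of_pc_zero]; exact hM
  -- `log|det(L·M)| − log|det L| − log|det M| + 0·log|det M| = 0` near `0`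
  have heq : ∀ᶠ u in 𝓝 (0 : ℝ),
      (1 : ℝ) * Real.log |(Matrix.of ((fun v => Matrix.of.symm (Matrix.of (pc L₀ L₁ L₂ v) * Matrix.of (pc M₀ M₁ M₂ v))) u)).det|
        + (-1) * Real.log |(Matrix.of (pc L₀ L₁ L₂ u)).det| + (-1) * Real.log |(Matrix.of (pc M₀ M₁ M₂ u)).det|
        + 0 * Real.log |(Matrix.of (pc M₀ M₁ M₂ u)).det| = 0 := by
    have hdL' : ∀ᶠ u in 𝓝 (0 : ℝ), (Matrix.of (pc L₀ L₁ L₂ u)).det ≠ 0 :=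
      Literature.Analysis.Calculus.eventually_det_ne_zero (hasDerivAt_pc L₀ L₁ L₂ 0).hasFDerivAt hdL
    have hdM' : ∀ᶠ u in 𝓝 (0 : ℝ), (Matrix.of (pc M₀ M₁ M₂ u)).det ≠ 0 :=
      Literature.Analysis.Calculus.eventually_det_ne_zero (hasDerivAt_pc M₀ M₁ M₂ 0).hasFDerivAt hdM
    filter_upwards [hdL', hdM'] with u huL huM
    show (1 : ℝ) * Real.log |(Matrix.of (Matrix.of.symm (Matrix.of (pc L₀ L₁ L₂ u) * Matrix.of (pc M₀ M₁ M₂ u)))).det| + _ + _ + _ = 0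
    rw [Equiv.apply_symm_apply, Matrix.det_mul, abs_mul, Real.log_mul (abs_ne_zero.mpr huL) (abs_ne_zero.mpr huM)]
    ring
  have h := secondVar_comb_eq_zero (Filter.Eventually.of_forall hCd) hC₁d hdC
    (Filter.Eventually.of_forall (hasDerivAt_pc L₀ L₁ L₂)) (hasDerivAt_lc L₁ L₂ 0) hdL
    (Filter.Eventually.of_forall (hasDerivAt_pc M₀ M₁ M₂)) (hasDerivAt_lc M₁ M₂ 0) hdM
    (Filter.Eventually.of_forall (hasDerivAt_pc M₀ M₁ M₂)) (hasDerivAt_lc M₁ M₂ 0) hdM heq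
  -- read the jets at `0`
  have e0 : Matrix.of ((fun v => Matrix.of.symm (Matrix.of (pc L₀ L₁ L₂ v) * Matrix.of (pc M₀ M₁ M₂ v))) 0) = L₀ * M₀ := by
    show Matrix.of (Matrix.of.symm (Matrix.of (pc L₀ L₁ L₂ 0) * Matrix.of (pc M₀ M₁ M₂ 0))) = _
    rw [Equiv.apply_symm_apply, of_pc_zero, of_pc_zero]
  have e1 : Matrix.of ((fun v => Matrix.of.symm (Matrix.of (lc L₁ L₂ v) * Matrix.of (pc M₀ M₁ M₂ v)
      + Matrix.of (pc L₀ L₁ L₂ v) * Matrix.of (lc M₁ M₂ v))) 0) = L₁ * M₀ + L₀ * M₁ := by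
    show Matrix.of (Matrix.of.symm (Matrix.of (lc L₁ L₂ 0) * Matrix.of (pc M₀ M₁ M₂ 0) + Matrix.of (pc L₀ L₁ L₂ 0) * Matrix.of (lc M₁ M₂ 0))) = _
    rw [Equiv.apply_symm_apply, of_pc_zero, of_pc_zero, of_lc_zero, of_lc_zero]
  have e2 : (Matrix.of.symm ((L₂ * Matrix.of (pc M₀ M₁ M₂ 0) + Matrix.of (lc L₁ L₂ 0) * Matrix.of (lc M₁ M₂ 0))
        + (Matrix.of (lc L₁ L₂ 0) * Matrix.of (lc M₁ M₂ 0) + Matrix.of (pc L₀ L₁ L₂ 0) * M₂)) : Matrix ι ι ℝ)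
      = L₂ * M₀ + L₁ * M₁ + (L₁ * M₁ + L₀ * M₂) := by
    rw [of_pc_zero, of_pc_zero, of_lc_zero, of_lc_zero]; rfl
  have eL : (Matrix.of.symm L₂ : Matrix ι ι ℝ) = L₂ := rfl
  have eM : (Matrix.of.symm M₂ : Matrix ι ι ℝ) = M₂ := rfl
  rw [e0, e1, e2, eL, eM, of_pc_zero, of_pc_zero, of_lc_zero, of_lc_zero] at h
  linarith

/-- [folklore] **THE SECOND VARIATION IS ADDITIVE OVER TRIPLE PRODUCTS** (`L·M·R`, the conjugation shape): the product 2-jet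
(`L₀(M₀R₀)`, `L₁(M₀R₀) + L₀(M₁R₀ + M₀R₁)`, the displayed second word) has `secondVar = secondVar L + secondVar M + secondVar R`. -/
theorem secondVar_mul₃ (L₀ L₁ L₂ M₀ M₁ M₂ R₀ R₁ R₂ : Matrix ι ι ℝ) (hL : L₀.det ≠ 0) (hM : M₀.det ≠ 0) (hR : R₀.det ≠ 0) :
    secondVar (L₀ * (M₀ * R₀)) (L₁ * (M₀ * R₀) + L₀ * (M₁ * R₀ + M₀ * R₁))
        (L₂ * (M₀ * R₀) + L₁ * (M₁ * R₀ + M₀ * R₁) + (L₁ * (M₁ * R₀ + M₀ * R₁) + L₀ * (M₂ * R₀ + M₁ * R₁ + (M₁ * R₁ + M₀ * R₂))))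
      = secondVar L₀ L₁ L₂ + secondVar M₀ M₁ M₂ + secondVar R₀ R₁ R₂ := by
  have hMR : (M₀ * R₀).det ≠ 0 := by rw [Matrix.det_mul]; exact mul_ne_zero hM hR
  rw [secondVar_mul₂ L₀ L₁ L₂ (M₀ * R₀) (M₁ * R₀ + M₀ * R₁) (M₂ * R₀ + M₁ * R₁ + (M₁ * R₁ + M₀ * R₂)) hL hMR,
    secondVar_mul₂ M₀ M₁ M₂ R₀ R₁ R₂ hM hR, add_assoc]

/-- [folklore] **CONJUGATION TRANSPORT**: if the transporting 2-jets are UNIMODULAR at jet level (`secondVar L₀ L₁ L₂ = 0`, `secondVar R₀ R₁ R₂ = 0`)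
then the conjugated 2-jet `L·M·R` has the `secondVar` of `M`. -/
theorem secondVar_conj_of_unimodular (L₀ L₁ L₂ M₀ M₁ M₂ R₀ R₁ R₂ : Matrix ι ι ℝ) (hL : L₀.det ≠ 0) (hM : M₀.det ≠ 0) (hR : R₀.det ≠ 0)
    (uL : secondVar L₀ L₁ L₂ = 0) (uR : secondVar R₀ R₁ R₂ = 0) :
    secondVar (L₀ * (M₀ * R₀)) (L₁ * (M₀ * R₀) + L₀ * (M₁ * R₀ + M₀ * R₁))
        (L₂ * (M₀ * R₀) + L₁ * (M₁ * R₀ + M₀ * R₁) + (L₁ * (M₁ * R₀ + M₀ * R₁) + L₀ * (M₂ * R₀ + M₁ * R₁ + (M₁ * R₁ + M₀ * R₂))))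
      = secondVar M₀ M₁ M₂ := by
  rw [secondVar_mul₃ L₀ L₁ L₂ M₀ M₁ M₂ R₀ R₁ R₂ hL hM hR, uL, uR, zero_add, add_zero]

end Product

/-! ## §2 The transports: transpose, block-diagonal sums, and the conjugation of a doubly bordered matrix -/

section Transport

variable {ν κ ρ : Type*} [Fintype ν] [Fintype κ] [Fintype ρ] [DecidableEq ν] [DecidableEq κ] [DecidableEq ρ]

omit [Fintype κ] [Fintype ρ] [DecidableEq κ] [DecidableEq ρ] in
/-- [folklore] **`secondVar` IS TRANSPOSE-INVARIANT** (`log|det Aᵀ| = log|det A|`). -/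
theorem secondVar_transpose (A₀ A₁ A₂ : Matrix ν ν ℝ) : secondVar A₀ᵀ A₁ᵀ A₂ᵀ = secondVar A₀ A₁ A₂ := by
  unfold secondVar
  rw [← Matrix.transpose_nonsing_inv, ← Matrix.transpose_mul, Matrix.trace_transpose, ← Matrix.transpose_mul, ← Matrix.transpose_mul,
    Matrix.trace_transpose, Matrix.trace_mul_comm A₂]
  congr 1
  -- `tr(A₁A₀⁻¹A₁A₀⁻¹) = tr(A₀⁻¹A₁A₀⁻¹A₁)`
  rw [Matrix.mul_assoc, Matrix.trace_mul_comm, ← Matrix.mul_assoc, Matrix.mul_assoc]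

omit [DecidableEq ν] [DecidableEq κ] [Fintype ρ] [DecidableEq ρ] in
/-- [folklore] the derivative of a block-diagonal curve `diag(A(u), D(u))` is `diag(A′, D′)`. -/
theorem hasDerivAt_fromBlocks_diag {A : ℝ → ν → ν → ℝ} {D : ℝ → κ → κ → ℝ} {A' : Matrix ν ν ℝ} {D' : Matrix κ κ ℝ} {t : ℝ}
    (hA : HasDerivAt A (Matrix.of.symm A') t) (hD : HasDerivAt D (Matrix.of.symm D') t) :
    HasDerivAt (fun u => Matrix.of.symm (fromBlocks (Matrix.of (A u)) (0 : Matrix ν κ ℝ) (0 : Matrix κ ν ℝ) (Matrix.of (D u))))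
      (Matrix.of.symm (fromBlocks A' (0 : Matrix ν κ ℝ) (0 : Matrix κ ν ℝ) D')) t := by
  refine hasDerivAt_pi.2 fun a => hasDerivAt_pi.2 fun b => ?_
  rcases a with i | m <;> rcases b with j | m'
  · simp only [Matrix.of_symm_apply, Matrix.fromBlocks_apply₁₁, Matrix.of_apply]
    exact (hasDerivAt_pi.1 ((hasDerivAt_pi.1 hA) i)) j
  · simp only [Matrix.of_symm_apply, Matrix.fromBlocks_apply₁₂, Matrix.zero_apply]
    exact hasDerivAt_const _ _
  · simp only [Matrix.of_symm_apply, Matrix.fromBlocks_apply₂₁, Matrix.zero_apply]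
    exact hasDerivAt_const _ _
  · simp only [Matrix.of_symm_apply, Matrix.fromBlocks_apply₂₂, Matrix.of_apply]
    exact (hasDerivAt_pi.1 ((hasDerivAt_pi.1 hD) m)) m'

omit [Fintype ρ] [DecidableEq ρ] in
/-- [folklore] **`secondVar` IS ADDITIVE OVER BLOCK-DIAGONAL SUMS**: `secondVar diag(A,D)-jets = secondVar A-jets + secondVar D-jets`
(`log|det diag(A,D)| = log|det A| + log|det D|`). -/
theorem secondVar_fromBlocks_diag (A₀ A₁ A₂ : Matrix ν ν ℝ) (D₀ D₁ D₂ : Matrix κ κ ℝ) (hA : A₀.det ≠ 0) (hD : D₀.det ≠ 0) :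
    secondVar (fromBlocks A₀ 0 0 D₀) (fromBlocks A₁ 0 0 D₁) (fromBlocks A₂ 0 0 D₂) = secondVar A₀ A₁ A₂ + secondVar D₀ D₁ D₂ := by
  have hCd : ∀ u, HasDerivAt (fun v => Matrix.of.symm (fromBlocks (Matrix.of (pc A₀ A₁ A₂ v)) (0 : Matrix ν κ ℝ) (0 : Matrix κ ν ℝ) (Matrix.of (pc D₀ D₁ D₂ v))))
      ((fun v => Matrix.of.symm (fromBlocks (Matrix.of (lc A₁ A₂ v)) (0 : Matrix ν κ ℝ) (0 : Matrix κ ν ℝ) (Matrix.of (lc D₁ D₂ v)))) u) u :=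
    fun u => hasDerivAt_fromBlocks_diag (hasDerivAt_pc A₀ A₁ A₂ u) (hasDerivAt_pc D₀ D₁ D₂ u)
  have hC₁d : HasDerivAt (fun v => Matrix.of.symm (fromBlocks (Matrix.of (lc A₁ A₂ v)) (0 : Matrix ν κ ℝ) (0 : Matrix κ ν ℝ) (Matrix.of (lc D₁ D₂ v))))
      (Matrix.of.symm (fromBlocks A₂ (0 : Matrix ν κ ℝ) (0 : Matrix κ ν ℝ) D₂)) 0 :=
    hasDerivAt_fromBlocks_diag (hasDerivAt_lc A₁ A₂ 0) (hasDerivAt_lc D₁ D₂ 0)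
  have hdA : (Matrix.of (pc A₀ A₁ A₂ 0)).det ≠ 0 := by rw [of_pc_zero]; exact hA
  have hdD : (Matrix.of (pc D₀ D₁ D₂ 0)).det ≠ 0 := by rw [of_pc_zero]; exact hD
  have hdC : (Matrix.of ((fun v => Matrix.of.symm (fromBlocks (Matrix.of (pc A₀ A₁ A₂ v)) (0 : Matrix ν κ ℝ) (0 : Matrix κ ν ℝ)
      (Matrix.of (pc D₀ D₁ D₂ v)))) 0)).det ≠ 0 := by
    show (Matrix.of (Matrix.of.symm (fromBlocks (Matrix.of (pc A₀ A₁ A₂ 0)) (0 : Matrix ν κ ℝ) (0 : Matrix κ ν ℝ) (Matrix.of (pc D₀ D₁ D₂ 0))))).det ≠ 0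
    rw [Equiv.apply_symm_apply, Matrix.det_fromBlocks_zero₁₂]; exact mul_ne_zero hdA hdD
  have heq : ∀ᶠ u in 𝓝 (0 : ℝ),
      (1 : ℝ) * Real.log |(Matrix.of ((fun v => Matrix.of.symm (fromBlocks (Matrix.of (pc A₀ A₁ A₂ v)) (0 : Matrix ν κ ℝ) (0 : Matrix κ ν ℝ)
          (Matrix.of (pc D₀ D₁ D₂ v)))) u)).det|
        + (-1) * Real.log |(Matrix.of (pc A₀ A₁ A₂ u)).det| + (-1) * Real.log |(Matrix.of (pc D₀ D₁ D₂ u)).det|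
        + 0 * Real.log |(Matrix.of (pc D₀ D₁ D₂ u)).det| = 0 := by
    have hdA' : ∀ᶠ u in 𝓝 (0 : ℝ), (Matrix.of (pc A₀ A₁ A₂ u)).det ≠ 0 :=
      Literature.Analysis.Calculus.eventually_det_ne_zero (hasDerivAt_pc A₀ A₁ A₂ 0).hasFDerivAt hdA
    have hdD' : ∀ᶠ u in 𝓝 (0 : ℝ), (Matrix.of (pc D₀ D₁ D₂ u)).det ≠ 0 :=
      Literature.Analysis.Calculus.eventually_det_ne_zero (hasDerivAt_pc D₀ D₁ D₂ 0).hasFDerivAt hdD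
    filter_upwards [hdA', hdD'] with u huA huD
    show (1 : ℝ) * Real.log |(Matrix.of (Matrix.of.symm (fromBlocks (Matrix.of (pc A₀ A₁ A₂ u)) (0 : Matrix ν κ ℝ) (0 : Matrix κ ν ℝ)
      (Matrix.of (pc D₀ D₁ D₂ u))))).det| + _ + _ + _ = 0
    rw [Equiv.apply_symm_apply, Matrix.det_fromBlocks_zero₁₂, abs_mul, Real.log_mul (abs_ne_zero.mpr huA) (abs_ne_zero.mpr huD)]
    ring
  have h := secondVar_comb_eq_zero (Filter.Eventually.of_forall hCd) hC₁d hdC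
    (Filter.Eventually.of_forall (hasDerivAt_pc A₀ A₁ A₂)) (hasDerivAt_lc A₁ A₂ 0) hdA
    (Filter.Eventually.of_forall (hasDerivAt_pc D₀ D₁ D₂)) (hasDerivAt_lc D₁ D₂ 0) hdD
    (Filter.Eventually.of_forall (hasDerivAt_pc D₀ D₁ D₂)) (hasDerivAt_lc D₁ D₂ 0) hdD heq
  have e0 : Matrix.of ((fun v => Matrix.of.symm (fromBlocks (Matrix.of (pc A₀ A₁ A₂ v)) (0 : Matrix ν κ ℝ) (0 : Matrix κ ν ℝ) (Matrix.of (pc D₀ D₁ D₂ v)))) 0)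
      = fromBlocks A₀ 0 0 D₀ := by
    show Matrix.of (Matrix.of.symm (fromBlocks (Matrix.of (pc A₀ A₁ A₂ 0)) (0 : Matrix ν κ ℝ) (0 : Matrix κ ν ℝ) (Matrix.of (pc D₀ D₁ D₂ 0)))) = _
    rw [Equiv.apply_symm_apply, of_pc_zero, of_pc_zero]
  have e1 : Matrix.of ((fun v => Matrix.of.symm (fromBlocks (Matrix.of (lc A₁ A₂ v)) (0 : Matrix ν κ ℝ) (0 : Matrix κ ν ℝ) (Matrix.of (lc D₁ D₂ v)))) 0)
      = fromBlocks A₁ 0 0 D₁ := by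
    show Matrix.of (Matrix.of.symm (fromBlocks (Matrix.of (lc A₁ A₂ 0)) (0 : Matrix ν κ ℝ) (0 : Matrix κ ν ℝ) (Matrix.of (lc D₁ D₂ 0)))) = _
    rw [Equiv.apply_symm_apply, of_lc_zero, of_lc_zero]
  have e2 : (Matrix.of.symm (fromBlocks A₂ (0 : Matrix ν κ ℝ) (0 : Matrix κ ν ℝ) D₂) : Matrix (ν ⊕ κ) (ν ⊕ κ) ℝ) = fromBlocks A₂ 0 0 D₂ := rfl
  have eA : (Matrix.of.symm A₂ : Matrix ν ν ℝ) = A₂ := rfl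
  have eD : (Matrix.of.symm D₂ : Matrix κ κ ℝ) = D₂ := rfl
  rw [e0, e1, e2, eA, eD, of_pc_zero, of_pc_zero, of_lc_zero, of_lc_zero] at h
  linarith

/-- [folklore] **THE TRANSPORTS OF THE BORDERED SYSTEM ARE UNIMODULAR IF THE FIELD AND MULTIPLIER TRANSPORTS ARE**: for
`L := diag(Aᵀ, Ā, c•1)`-jets with `(c₀, c₁, c₂) = (1, 0, 0)` on the slice block, `secondVar L-jets = secondVar A-jets + secondVar Ā-jets`. -/
theorem secondVar_transportL (A₀ A₁ A₂ : Matrix ν ν ℝ) (Ā₀ Ā₁ Ā₂ : Matrix κ κ ℝ) (hA : A₀.det ≠ 0) (hĀ : Ā₀.det ≠ 0) :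
    secondVar (fromBlocks A₀ᵀ 0 0 (fromBlocks Ā₀ 0 0 (1 : Matrix ρ ρ ℝ))) (fromBlocks A₁ᵀ 0 0 (fromBlocks Ā₁ 0 0 (0 : Matrix ρ ρ ℝ)))
        (fromBlocks A₂ᵀ 0 0 (fromBlocks Ā₂ 0 0 (0 : Matrix ρ ρ ℝ)))
      = secondVar A₀ A₁ A₂ + secondVar Ā₀ Ā₁ Ā₂ := by
  have hĀ1 : (fromBlocks Ā₀ 0 0 (1 : Matrix ρ ρ ℝ)).det ≠ 0 := by
    rw [Matrix.det_fromBlocks_zero₁₂, Matrix.det_one, mul_one]; exact hĀ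
  have hAt : A₀ᵀ.det ≠ 0 := by rw [Matrix.det_transpose]; exact hA
  rw [secondVar_fromBlocks_diag _ _ _ _ _ _ hAt hĀ1, secondVar_fromBlocks_diag _ _ _ _ _ _ hĀ (by rw [Matrix.det_one]; exact one_ne_zero),
    secondVar_transpose, secondVar_zero_jets, add_zero]

/-- [folklore] the same for the right transport `R := diag(A, Āᵀ, c•1)`. -/
theorem secondVar_transportR (A₀ A₁ A₂ : Matrix ν ν ℝ) (Ā₀ Ā₁ Ā₂ : Matrix κ κ ℝ) (hA : A₀.det ≠ 0) (hĀ : Ā₀.det ≠ 0) :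
    secondVar (fromBlocks A₀ 0 0 (fromBlocks Ā₀ᵀ 0 0 (1 : Matrix ρ ρ ℝ))) (fromBlocks A₁ 0 0 (fromBlocks Ā₁ᵀ 0 0 (0 : Matrix ρ ρ ℝ)))
        (fromBlocks A₂ 0 0 (fromBlocks Ā₂ᵀ 0 0 (0 : Matrix ρ ρ ℝ)))
      = secondVar A₀ A₁ A₂ + secondVar Ā₀ Ā₁ Ā₂ := by
  have hĀt : Ā₀ᵀ.det ≠ 0 := by rw [Matrix.det_transpose]; exact hĀ
  have hĀ1 : (fromBlocks Ā₀ᵀ 0 0 (1 : Matrix ρ ρ ℝ)).det ≠ 0 := by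
    rw [Matrix.det_fromBlocks_zero₁₂, Matrix.det_one, mul_one]; exact hĀt
  rw [secondVar_fromBlocks_diag _ _ _ _ _ _ hA hĀ1, secondVar_fromBlocks_diag _ _ _ _ _ _ hĀt (by rw [Matrix.det_one]; exact one_ne_zero),
    secondVar_transpose, secondVar_zero_jets, add_zero]

omit [DecidableEq ν] [DecidableEq κ] in
/-- [folklore] **CONJUGATING A DOUBLY BORDERED MATRIX BY BLOCK-DIAGONAL TRANSPORTS** (trilinear; scalar on the slice block):
`diag(Xᵀ, Y, c•1) · kkt K [Q; T] · diag(X′, Y′ᵀ, c′•1) = [[XᵀKX′, (Y′QX | c′•TX)ᵀ], [(YQX′ | c•TX′), 0]]`.  Summed over the product-rule index patterns of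
two transport 2-jets `(Aᵀ, Ā, (1,0,0))`, `(A, Āᵀ, (1,0,0))` this gives the conjugated `kkt`-jets `kkt (AᵀKA)ₙ [(ĀQA)ₙ; T·(A⁻¹A)ₙ]` of W-FP-17-11 (T-β). -/
theorem conj_kkt_fromRows (X X' : Matrix ν ν ℝ) (Y Y' : Matrix κ κ ℝ) (c c' : ℝ) (K : Matrix ν ν ℝ) (Q : Matrix κ ν ℝ) (T : Matrix ρ ν ℝ) :
    fromBlocks Xᵀ 0 0 (fromBlocks Y 0 0 (c • (1 : Matrix ρ ρ ℝ))) * kkt K (fromRows Q T) * fromBlocks X' 0 0 (fromBlocks Y'ᵀ 0 0 (c' • (1 : Matrix ρ ρ ℝ)))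
      = fromBlocks (Xᵀ * K * X') (fromRows (Y' * Q * X) (c' • (T * X)))ᵀ (fromRows (Y * Q * X') (c • (T * X'))) 0 := by
  simp only [kkt, Matrix.fromBlocks_multiply, Matrix.mul_zero, Matrix.zero_mul, add_zero, zero_add,
    Matrix.transpose_fromRows, Matrix.fromBlocks_mul_fromRows, Matrix.fromRows_mul, Matrix.fromCols_mul_fromBlocks, Matrix.mul_fromCols]
  congr 1
  · simp only [Matrix.transpose_mul, Matrix.transpose_smul, Matrix.mul_assoc, Matrix.mul_smul, Matrix.mul_one]
  · simp only [Matrix.one_mul, Matrix.smul_mul, Matrix.mul_assoc]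

omit [DecidableEq κ] in
/-- [folklore] **THE TRANSPORTED BASE POINT IS A BORDERED SYSTEM WITH THE SLICE RESTORED**: with `B₀A₀ = 1` (the inverse letter at order 0),
`diag(A₀ᵀ, Ā₀, 1) · kkt K₀ [Q₀; τB₀] · diag(A₀, Ā₀ᵀ, 1) = kkt (A₀ᵀK₀A₀) [Ā₀Q₀A₀; τ]` — the zeroth conjugated word of `secondVar_conj_of_unimodular` at the transports
of `secondVar_transportL∕R`. (The first and second words are the corresponding product-rule sums of `conj_kkt_fromRows` terms; on request.) -/
theorem conj_kkt_base (A₀ B₀ K₀ : Matrix ν ν ℝ) (Ā₀ : Matrix κ κ ℝ) (Q₀ : Matrix κ ν ℝ) (τ : Matrix ρ ν ℝ) (b0 : B₀ * A₀ = 1) :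
    fromBlocks A₀ᵀ 0 0 (fromBlocks Ā₀ 0 0 ((1 : ℝ) • (1 : Matrix ρ ρ ℝ))) * kkt K₀ (fromRows Q₀ (τ * B₀))
        * fromBlocks A₀ 0 0 (fromBlocks Ā₀ᵀ 0 0 ((1 : ℝ) • (1 : Matrix ρ ρ ℝ)))
      = kkt (A₀ᵀ * K₀ * A₀) (fromRows (Ā₀ * Q₀ * A₀) τ) := by
  rw [conj_kkt_fromRows, Matrix.mul_assoc τ, b0, Matrix.mul_one, one_smul]
  rfl

end Transport

/-! ## §3 Moving unimodular factors (memo §23 (T-β-4): the re-parametrised generators) -/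

section Unimodular

variable {ι : Type*} [Fintype ι] [DecidableEq ι]

/-- [folklore] **A MOVING RIGHT FACTOR THAT IS UNIMODULAR AT JET LEVEL DOES NOT CHANGE THE SECOND VARIATION**: `secondVar C-jets = 0 ⇒ secondVar (M·C)-jets =
secondVar M-jets` (use: the gauge generators re-parametrised by a moving unimodular `C(u)` — the intertwining letter `B·W(h) = W(h^g)·C` of memo §23 (T-β-4)). -/
theorem secondVar_mul_right_of_unimodular (M₀ M₁ M₂ C₀ C₁ C₂ : Matrix ι ι ℝ) (hM : M₀.det ≠ 0) (hC : C₀.det ≠ 0) (uC : secondVar C₀ C₁ C₂ = 0) :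
    secondVar (M₀ * C₀) (M₁ * C₀ + M₀ * C₁) (M₂ * C₀ + M₁ * C₁ + (M₁ * C₁ + M₀ * C₂)) = secondVar M₀ M₁ M₂ := by
  rw [secondVar_mul₂ M₀ M₁ M₂ C₀ C₁ C₂ hM hC, uC, add_zero]

/-- [folklore] the same for a moving unimodular LEFT factor. -/
theorem secondVar_mul_left_of_unimodular (C₀ C₁ C₂ M₀ M₁ M₂ : Matrix ι ι ℝ) (hC : C₀.det ≠ 0) (hM : M₀.det ≠ 0) (uC : secondVar C₀ C₁ C₂ = 0) :
    secondVar (C₀ * M₀) (C₁ * M₀ + C₀ * M₁) (C₂ * M₀ + C₁ * M₁ + (C₁ * M₁ + C₀ * M₂)) = secondVar M₀ M₁ M₂ := by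
  rw [secondVar_mul₂ C₀ C₁ C₂ M₀ M₁ M₂ hC hM, uC, zero_add]

end Unimodular

/-! ## §4 The conjugated words are bordered systems (v1.5: the first word; v1.6: the second) -/

section Words

variable {ν κ ρ : Type*} [Fintype ν] [Fintype κ] [Fintype ρ] [DecidableEq ν] [DecidableEq κ] [DecidableEq ρ]

omit [Fintype ν] [Fintype κ] [Fintype ρ] [DecidableEq ν] [DecidableEq κ] [DecidableEq ρ] in
/-- [folklore] row-block addition. -/
theorem fromRows_add' (A A' : Matrix κ ν ℝ) (B B' : Matrix ρ ν ℝ) : fromRows A B + fromRows A' B' = fromRows (A + A') (B + B') := by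
  ext (i | i) j <;> rfl

omit [Fintype ν] [Fintype κ] [Fintype ρ] [DecidableEq ν] [DecidableEq κ] [DecidableEq ρ] in
/-- [folklore] three pre-`kkt` blocks sum to a pre-`kkt` block. -/
theorem preKkt_add₃ (K₁ K₂ K₃ : Matrix ν ν ℝ) (F₁ F₂ F₃ G₁ G₂ G₃ : Matrix (κ ⊕ ρ) ν ℝ) :
    fromBlocks K₁ F₁ᵀ G₁ (0 : Matrix (κ ⊕ ρ) (κ ⊕ ρ) ℝ) + fromBlocks K₂ F₂ᵀ G₂ 0 + fromBlocks K₃ F₃ᵀ G₃ 0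
      = fromBlocks (K₁ + K₂ + K₃) (F₁ + F₂ + F₃)ᵀ (G₁ + G₂ + G₃) 0 := by
  rw [Matrix.fromBlocks_add, Matrix.fromBlocks_add, Matrix.transpose_add, Matrix.transpose_add, add_zero, add_zero]

omit [DecidableEq ν] [DecidableEq κ] in
/-- [folklore] **THE FIRST CONJUGATED WORD IS A BORDERED SYSTEM WITH ZERO SLICE JET**: with the first inverse letter `B₁A₀ + B₀A₁ = 0`,
`L₁(M₀R₀) + L₀(M₁R₀ + M₀R₁) = kkt (A₁ᵀK₀A₀ + A₀ᵀK₁A₀ + A₀ᵀK₀A₁) [Ā₁Q₀A₀ + Ā₀Q₁A₀ + Ā₀Q₀A₁; 0]`. -/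
theorem conj_kkt_first (A₀ A₁ B₀ B₁ K₀ K₁ : Matrix ν ν ℝ) (Ā₀ Ā₁ : Matrix κ κ ℝ) (Q₀ Q₁ : Matrix κ ν ℝ) (τ : Matrix ρ ν ℝ)
    (b1 : B₁ * A₀ + B₀ * A₁ = 0) :
    fromBlocks A₁ᵀ 0 0 (fromBlocks Ā₁ 0 0 ((0 : ℝ) • (1 : Matrix ρ ρ ℝ)))
        * (kkt K₀ (fromRows Q₀ (τ * B₀)) * fromBlocks A₀ 0 0 (fromBlocks Ā₀ᵀ 0 0 ((1 : ℝ) • (1 : Matrix ρ ρ ℝ))))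
      + fromBlocks A₀ᵀ 0 0 (fromBlocks Ā₀ 0 0 ((1 : ℝ) • (1 : Matrix ρ ρ ℝ)))
        * (kkt K₁ (fromRows Q₁ (τ * B₁)) * fromBlocks A₀ 0 0 (fromBlocks Ā₀ᵀ 0 0 ((1 : ℝ) • (1 : Matrix ρ ρ ℝ)))
          + kkt K₀ (fromRows Q₀ (τ * B₀)) * fromBlocks A₁ 0 0 (fromBlocks Ā₁ᵀ 0 0 ((0 : ℝ) • (1 : Matrix ρ ρ ℝ))))
      = kkt (A₁ᵀ * K₀ * A₀ + A₀ᵀ * K₁ * A₀ + A₀ᵀ * K₀ * A₁) (fromRows (Ā₁ * Q₀ * A₀ + Ā₀ * Q₁ * A₀ + Ā₀ * Q₀ * A₁) (0 : Matrix ρ ν ℝ)) := by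
  rw [Matrix.mul_add, ← Matrix.mul_assoc, ← Matrix.mul_assoc, ← Matrix.mul_assoc, conj_kkt_fromRows, conj_kkt_fromRows, conj_kkt_fromRows,
    ← add_assoc, preKkt_add₃, kkt]
  have hb : τ * B₀ * A₁ + τ * B₁ * A₀ = 0 := by
    rw [Matrix.mul_assoc, Matrix.mul_assoc, ← Matrix.mul_add, add_comm, b1, Matrix.mul_zero]
  congr 1
  · -- top-right block
    rw [fromRows_add', fromRows_add', Matrix.transpose_fromRows, Matrix.transpose_fromRows]
    congr 1
    · congr 1; abel
    · rw [one_smul, one_smul, zero_smul, add_zero, hb, Matrix.transpose_zero]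
  · -- bottom-left block
    rw [fromRows_add', fromRows_add']
    congr 1
    rw [one_smul, one_smul, zero_smul, zero_add, add_comm, hb]

omit [DecidableEq ν] [DecidableEq κ] in
/-- [folklore] **THE SECOND CONJUGATED WORD IS A BORDERED SYSTEM WITH ZERO SLICE JET**: with the second inverse letter `B₂A₀ + 2•B₁A₁ + B₀A₂ = 0`, the second
product-rule word of `secondVar_mul₃` ∕ `secondVar_conj_of_unimodular` at the transports `Lₙ := diag(Aₙᵀ, Āₙ, (1,0,0)ₙ)`, `Rₙ := diag(Aₙ, Āₙᵀ, (1,0,0)ₙ)`,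
`Mₙ := kkt Kₙ [Qₙ; τBₙ]` IS `kkt (AᵀKA)₂ [(ĀQA)₂; 0]` (the nine-term product-rule words, grouped as in `secondVar_mul₃`). -/
theorem conj_kkt_second (A₀ A₁ A₂ B₀ B₁ B₂ K₀ K₁ K₂ : Matrix ν ν ℝ) (Ā₀ Ā₁ Ā₂ : Matrix κ κ ℝ) (Q₀ Q₁ Q₂ : Matrix κ ν ℝ) (τ : Matrix ρ ν ℝ)
    (b2 : B₂ * A₀ + (2 : ℝ) • (B₁ * A₁) + B₀ * A₂ = 0) :
    let L₀ := fromBlocks A₀ᵀ 0 0 (fromBlocks Ā₀ 0 0 ((1 : ℝ) • (1 : Matrix ρ ρ ℝ)))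
    let L₁ := fromBlocks A₁ᵀ 0 0 (fromBlocks Ā₁ 0 0 ((0 : ℝ) • (1 : Matrix ρ ρ ℝ)))
    let L₂ := fromBlocks A₂ᵀ 0 0 (fromBlocks Ā₂ 0 0 ((0 : ℝ) • (1 : Matrix ρ ρ ℝ)))
    let R₀ := fromBlocks A₀ 0 0 (fromBlocks Ā₀ᵀ 0 0 ((1 : ℝ) • (1 : Matrix ρ ρ ℝ)))
    let R₁ := fromBlocks A₁ 0 0 (fromBlocks Ā₁ᵀ 0 0 ((0 : ℝ) • (1 : Matrix ρ ρ ℝ)))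
    let R₂ := fromBlocks A₂ 0 0 (fromBlocks Ā₂ᵀ 0 0 ((0 : ℝ) • (1 : Matrix ρ ρ ℝ)))
    let M₀ := kkt K₀ (fromRows Q₀ (τ * B₀))
    let M₁ := kkt K₁ (fromRows Q₁ (τ * B₁))
    let M₂ := kkt K₂ (fromRows Q₂ (τ * B₂))
    L₂ * (M₀ * R₀) + L₁ * (M₁ * R₀ + M₀ * R₁) + (L₁ * (M₁ * R₀ + M₀ * R₁) + L₀ * (M₂ * R₀ + M₁ * R₁ + (M₁ * R₁ + M₀ * R₂)))
      = kkt (A₂ᵀ * K₀ * A₀ + (A₁ᵀ * K₁ * A₀ + A₁ᵀ * K₀ * A₁) + ((A₁ᵀ * K₁ * A₀ + A₁ᵀ * K₀ * A₁) + (A₀ᵀ * K₂ * A₀ + A₀ᵀ * K₁ * A₁ + (A₀ᵀ * K₁ * A₁ + A₀ᵀ * K₀ * A₂))))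
          (fromRows (Ā₂ * Q₀ * A₀ + (Ā₁ * Q₁ * A₀ + Ā₁ * Q₀ * A₁) + ((Ā₁ * Q₁ * A₀ + Ā₁ * Q₀ * A₁) + (Ā₀ * Q₂ * A₀ + Ā₀ * Q₁ * A₁ + (Ā₀ * Q₁ * A₁ + Ā₀ * Q₀ * A₂))))
            (0 : Matrix ρ ν ℝ)) := by
  intro L₀ L₁ L₂ R₀ R₁ R₂ M₀ M₁ M₂
  simp only [L₀, L₁, L₂, R₀, R₁, R₂, M₀, M₁, M₂, Matrix.mul_add, ← Matrix.mul_assoc, conj_kkt_fromRows]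
  have hb : τ * B₀ * A₂ + (τ * B₁ * A₁ + (τ * B₁ * A₁ + τ * B₂ * A₀)) = 0 := by
    have : τ * (B₂ * A₀ + (2 : ℝ) • (B₁ * A₁) + B₀ * A₂) = 0 := by rw [b2, Matrix.mul_zero]
    rw [Matrix.mul_add, Matrix.mul_add, Matrix.mul_smul, two_smul] at this
    simp only [Matrix.mul_assoc]
    rw [← this]; abel
  have hbt : (τ * B₀ * A₂)ᵀ + ((τ * B₁ * A₁)ᵀ + ((τ * B₁ * A₁)ᵀ + (τ * B₂ * A₀)ᵀ)) = 0 := by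
    rw [← Matrix.transpose_add, ← Matrix.transpose_add, ← Matrix.transpose_add, hb, Matrix.transpose_zero]
  simp only [kkt, Matrix.fromBlocks_add, fromRows_add', Matrix.transpose_fromRows, Matrix.transpose_add, add_zero, one_smul, zero_smul, zero_add,
    Matrix.transpose_zero, fromCols_add]
  congr 1
  · congr 1
    all_goals first | abel1 | (rw [← hbt]; abel1)
  · congr 1
    all_goals first | abel1 | (rw [← hb]; abel1)

end Words

end Summit.QuantumFields.BalabanUV.Beta.FP.SliceTransportConjugation

end
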